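import Literature.AnabelianGeometry.EtaleTheta.Discharge.Sec4RootTransportTwisted

/-!
# [EtTh] Rmk. 4.3.2 / Thm. 5.7: REBASING the level-`N` root over the level-`1` root along the transition `(α_{1,N}, β_{1,N})`
# — `NthRoot.rebase`, and Prop. 4.2 (iv) at the twisted LEVEL-1 pair (R219 final knit, FILE 2 infrastructure)

S. Mochizuki, *The étale theta function and its Frobenioid-theoretic manifestations*, Publ. RIMS **45** (2009)
[cite: MochizukiEtTh2009, Rmk 4.3.2 p.318–319 (PDF pp.92–93); Prop 4.2 (iii)(iv) p.314–315 (PDF pp.88–89); Thm 5.7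
p.329–330 (PDF pp.103–104); Def 4.1 (iv) p.313 (PDF p.87)].

abc-iut cell, layer L2, row R219 FINAL KNIT (holder abc-iut-L2-d4 g5; design STATUS 11:23:35Z «every level rebased over the
LEVEL-1 pair; the anchor is NOT a member of the family»), seat abc-iut-f-121 (gen 2).  Over abc-iut-L2-t3's law-free §4
interface (`BiKummerRoots.lean`: `NthRoot`) and this lineage's `Discharge/Sec4RootTransportTwisted.lean` (p438241).

WHY.  "By allowing `N` to vary, we obtain a compatible system of roots" (Rmk. 4.3.2, p.319): in a compatible family
`(R_N)_N` of `N`-th roots of ONE fraction-pair `(s′, s″)` of `f` on `(A, B)` with transitions `α_{1,N} : A_N → A_1`,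
`β_{1,N} : B_N → B_1` over the base pair, the level-`N` root `(A_N, B_N, α_N, β_N, f_N, (s′_N, s″_N))` IS ALSO an `N`-th root of
the LEVEL-1 pair `(s′_1, s″_1)` of `f_1` on `(A_1, B_1)`, with structure maps the transitions.  abc-iut-L2-d4's final knit of
Thm. 5.7 applies Prop. 4.2 (iv) at every level to THIS rebased root `R̃_N`, with the normalised level-1 anchor
`(eA, eB, u) := (α_1, β_1, u_1)` — so that the coherence clauses of p438241 (`a⁻¹ ≫ Ψ α ≫ eA = α`, `b⁻¹ ≫ Ψ β ≫ eB = β`) are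
LITERALLY the transition compatibilities `hΨα`/`hΨβ` of the capstone, and `he` disappears.

WHAT THIS FILE GIVES.
* `NthRoot.rebase` — the constructor of `R̃_N : NthRoot R₁.root R₁.pair N` from `R : NthRoot f P N`, a level-1 root
  `R₁ : NthRoot f P 1`, the transition `(a, b)` with its two commutative squares (`comm_num`, `comm_den` — the tower's
  `comm_sCap`/`comm_sCup` verbatim), "isometries of Frobenius degree `N`" (`ha`, `hb`, `hdega`, `hdegb`), and EXACTLY the two
  inputs the §4 interface cannot see (the duals of abc-iut-w5-d234's (C1)/(C1′) in `BiKummerRootComposition.lean`,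
  `NthRoot.comp`): (B1) `D : S.BaseFrobeniusTypeData a` — a Def. 4.1 (iv) DATUM for the transition (the tower carries only
  `IsOfBaseFrobeniusType = Nonempty`, and the clauses below must hold for the datum USED, so it is named); (B1′)
  `hD : pullFrac D.α₁ R₁.root = pullFrac R.αData.α₁ f` — the pull-back factor of `α_{1,N}` pulls `f_1` back to `f|_{A_N}`
  ([FrdI] Prop. 1.11 (iv) functoriality of `(·)^*` at the model; NOT a consequence of `α_{1,N} ≫ α_1 = α_N`, which speaks
  about the composite `α = α″ ≫ α′`, while `NthRoot.pow_root`/`isSaturated` are stated through the factor `α′ = αData.α₁`).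
  Then `pow_root := hD ▸ R.pow_root`, `isSaturated := hD ▸ R.isSaturated` are PROVED; all field lemmas are `rfl`.
* `NthRoot.exists_unit_transport_twisted_rebase` — p438241's per-level datum `(a, b, e := 1, D_c := 1, D_p := v·ũ)` AT
  `R̃_N`, with its two coherence clauses displayed in transition form (`… Ψ.map a ≫ eA.hom = a`, `… Ψ.map b ≫ eB.hom = b`):
  the generic-setting half of FILE 2 (the instantiation at the genuine connected tower is abc-iut-w5-d245's).
HONEST FRAMING: one structure-valued constructor over a frozen interface and kernel-checked identities; every [FrdI]/[EtTh]
input is a NAMED binder dischargeable at the model; refereed pre-IUT material; nothing here bears on [IUTchIII] Cor. 3.12 or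
takes a side; typed ≠ proved for genuine data.
-/

noncomputable section

namespace Literature.AnabelianGeometry.EtaleTheta

open CategoryTheory Opposite Literature.AlgebraicGeometry.Frobenioids

namespace BiKummerSetting

universe u₀ v₀ u v w

variable {K : Type u₀} [Field K] {D₀ : Type u₀} [Category.{v₀} D₀] {V : FrdIMonoidStub.{w}}
  {X₁ : SemiGraphs.TemperedArithmeticGroup.{u₀} K} {T₁ : RealifiedDivisorMonoids (D₀ := D₀) V}
  {D₁ : Type u} [Category.{v} D₁] {VD₁ : FrdICatStub.{u, v, w} D₁} {S : BiKummerSetting X₁ T₁ D₁ VD₁}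

namespace NthRoot

/-! ### §1. `NthRoot.rebase`: the level-`N` root as an `N`-th root of the level-`1` pair -/

section

variable {A B : S.C} {f : S.biratUnits A} {P : S.FractionPair f B} {N : ℕ+}
    {pullFrac : ∀ {A A' : S.C} (_ : A' ⟶ A), S.biratUnits A → S.biratUnits A'}
    (R : S.NthRoot f P N pullFrac) (R₁ : S.NthRoot f P 1 pullFrac)
    (a : R.AN ⟶ R₁.AN) (b : R.BN ⟶ R₁.BN)
    (comm_num : R.pair.num ≫ b = a ≫ R₁.pair.num) (comm_den : R.pair.den ≫ b = a ≫ R₁.pair.den)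
    (ha : S.IsIsometry a) (hb : S.IsIsometry b) (hdega : S.degFr a = N) (hdegb : S.degFr b = N)
    (D : S.BaseFrobeniusTypeData a) (hD : pullFrac D.α₁ R₁.root = pullFrac R.αData.α₁ f)

/-- **Rebasing the level-`N` root over the level-`1` root** (Rmk. 4.3.2, pp.318–319 (PDF pp.92–93): "compatible systems of
roots"): from an `N`-th root `R = (A_N, B_N, α_N, β_N, f_N, (s′_N, s″_N))` and a first root `R₁ = (A_1, B_1, α_1, β_1, f_1,
(s′_1, s″_1))` of the same fraction-pair, and a transition `(a, b) = (α_{1,N}, β_{1,N})` with the two commutative squares,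
isometries of Frobenius degree `N`, `a` of base-Frobenius type with datum `D` (B1) whose pull-back factor satisfies
`(D.α₁)^* f_1 = (α′_N)^* f` (B1′), the diagram `(A_N, B_N, a, b, f_N, (s′_N, s″_N))` is an `N`-th root of the level-1 pair
`(s′_1, s″_1)` of `f_1` — the power law `f_N^N = (D.α₁)^* f_1` and the `(N, H_⊙, (D.α₁)^* f_1)`-saturation of `A_N` being `R`'s own
clauses rewritten along (B1′). [cite: MochizukiEtTh2009, Rmk 4.3.2 p.318–319 (PDF pp.92–93); Prop 4.2 (iii) p.314 (PDF p.88)] -/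
def rebase : S.NthRoot R₁.root R₁.pair N pullFrac where
  AN := R.AN
  BN := R.BN
  α := a
  β := b
  root := R.root
  pair := R.pair
  comm_num := comm_num
  comm_den := comm_den
  isIsometry := ⟨ha, hb, hdega, hdegb⟩
  αData := D
  pow_root := by rw [hD]; exact R.pow_root
  isSaturated := by rw [hD]; exact R.isSaturated

/-- `N`-domain of the rebased root is `A_N`. [cite: MochizukiEtTh2009, Rmk 4.3.2 p.318 (PDF p.92)] -/
@[simp] theorem rebase_AN : (R.rebase R₁ a b comm_num comm_den ha hb hdega hdegb D hD).AN = R.AN := rfl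

/-- `N`-codomain of the rebased root is `B_N`. [cite: MochizukiEtTh2009, Rmk 4.3.2 p.318 (PDF p.92)] -/
@[simp] theorem rebase_BN : (R.rebase R₁ a b comm_num comm_den ha hb hdega hdegb D hD).BN = R.BN := rfl

/-- The structure map to `A_1` is the transition `α_{1,N}`. [cite: MochizukiEtTh2009, Rmk 4.3.2 p.318 (PDF p.92)] -/
@[simp] theorem rebase_α : (R.rebase R₁ a b comm_num comm_den ha hb hdega hdegb D hD).α = a := rfl

/-- The structure map to `B_1` is the transition `β_{1,N}`. [cite: MochizukiEtTh2009, Rmk 4.3.2 p.318 (PDF p.92)] -/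
@[simp] theorem rebase_β : (R.rebase R₁ a b comm_num comm_den ha hb hdega hdegb D hD).β = b := rfl

/-- The root element is `f_N`. [cite: MochizukiEtTh2009, Rmk 4.3.2 p.318 (PDF p.92)] -/
@[simp] theorem rebase_root : (R.rebase R₁ a b comm_num comm_den ha hb hdega hdegb D hD).root = R.root := rfl

/-- The root pair is `(s′_N, s″_N)`. [cite: MochizukiEtTh2009, Rmk 4.3.2 p.318 (PDF p.92)] -/
@[simp] theorem rebase_pair : (R.rebase R₁ a b comm_num comm_den ha hb hdega hdegb D hD).pair = R.pair := rfl

/-- `s′_N` unchanged. [cite: MochizukiEtTh2009, Rmk 4.3.2 p.318 (PDF p.92)] -/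
@[simp] theorem rebase_pair_num : (R.rebase R₁ a b comm_num comm_den ha hb hdega hdegb D hD).pair.num = R.pair.num := rfl

/-- `s″_N` unchanged. [cite: MochizukiEtTh2009, Rmk 4.3.2 p.318 (PDF p.92)] -/
@[simp] theorem rebase_pair_den : (R.rebase R₁ a b comm_num comm_den ha hb hdega hdegb D hD).pair.den = R.pair.den := rfl

/-- The Def. 4.1 (iv) datum of the rebased root is the named datum `D` of the transition (B1).
[cite: MochizukiEtTh2009, Def 4.1 (iv) p.313 (PDF p.87)] -/
@[simp] theorem rebase_αData : (R.rebase R₁ a b comm_num comm_den ha hb hdega hdegb D hD).αData = D := rfl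

/-- **Compatibility with the structure maps down to the base** (Rmk. 4.3.2: the transitions lie over `(A, B)`): if
`α_{1,N} ≫ α_1 = α_N` then the rebased root followed by the first root recovers `R`'s structure map — recorded for the
consumer's `hαover` bookkeeping. [cite: MochizukiEtTh2009, Rmk 4.3.2 p.318–319 (PDF pp.92–93)] -/
theorem rebase_α_comp (hαover : a ≫ R₁.α = R.α) :
    (R.rebase R₁ a b comm_num comm_den ha hb hdega hdegb D hD).α ≫ R₁.α = R.α := hαover

/-- The `β`-companion of `rebase_α_comp`. [cite: MochizukiEtTh2009, Rmk 4.3.2 p.318–319 (PDF pp.92–93)] -/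
theorem rebase_β_comp (hβover : b ≫ R₁.β = R.β) :
    (R.rebase R₁ a b comm_num comm_den ha hb hdega hdegb D hD).β ≫ R₁.β = R.β := hβover

end

/-! ### §2. Prop. 4.2 (iv) at the twisted LEVEL-1 pair, applied to the rebased root (p438241 at `R̃_N`) -/

section

variable (h : Thm44Hyp S S) (ψ : ∀ A : S.C, S.biratUnits A ≃* S.biratUnits (h.Ψ.functor.obj A))
    (pullFrac : ∀ {A A' : S.C} (_ : A' ⟶ A), S.biratUnits A → S.biratUnits A')
    (hpull : ∀ {A A' : S.C} (φ : A' ⟶ A) (f : S.biratUnits A),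
      ψ A' (pullFrac φ f) = pullFrac (h.Ψ.functor.map φ) (ψ A f))
    (hii : Thm44_ii h ψ) (h3 : h.PreservesFrobeniusStructure) (h4b : h.PreservesBaseFrobeniusTypeData)
    (h8 : h.PreservesAmple) (h15a : h.PreservesFixedByHA ψ) (h15 : h.PreservesSaturated ψ)
    {A B : S.C} {f : S.biratUnits A} {P : S.FractionPair f B} {N : ℕ+}
    -- the level-`N` root, the level-`1` root and the transition (inputs of `rebase`)
    (R : S.NthRoot f P N pullFrac) (R₁ : S.NthRoot f P 1 pullFrac)
    (a : R.AN ⟶ R₁.AN) (b : R.BN ⟶ R₁.BN)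
    (comm_num : R.pair.num ≫ b = a ≫ R₁.pair.num) (comm_den : R.pair.den ≫ b = a ≫ R₁.pair.den)
    (ha : S.IsIsometry a) (hb : S.IsIsometry b) (hdega : S.degFr a = N) (hdegb : S.degFr b = N)
    (D : S.BaseFrobeniusTypeData a) (hD : pullFrac D.α₁ R₁.root = pullFrac R.αData.α₁ f)
    -- the unit discrepancy at the LEVEL-1 pair and the twisted level-1 pair
    (u : Aut R₁.BN) (hu : u ∈ S.units R₁.BN) {f' : S.biratUnits R₁.AN}
    (hfrac : S.fracOf R₁.pair.num (R₁.pair.den ≫ u.hom) R₁.pair.isPreStep_num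
      (S.isPreStep_comp_aut R₁.pair.isPreStep_den u) (S.baseEquivalent_comp_unit R₁.pair.base_eq hu) = f')
    (hdisj : S.DisjointSupports (S.div R₁.pair.num) (S.div (R₁.pair.den ≫ u.hom)))
    -- the normalised level-1 anchor `(eA, eB) = (α_1, β_1)` (`D_c = 1`, unit `u = u_1`)
    (eA : h.Ψ.functor.obj R₁.AN ≅ R₁.AN) (eB : h.Ψ.functor.obj R₁.BN ≅ R₁.BN)
    (hnum : eA.inv ≫ h.Ψ.functor.map R₁.pair.num ≫ eB.hom = R₁.pair.num)
    (hden : eA.inv ≫ h.Ψ.functor.map R₁.pair.den ≫ eB.hom = R₁.pair.den ≫ u.hom)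
    (hf : pullFrac eA.hom f' = ψ R₁.AN R₁.root) (heA : S.IsIsometry eA.hom) (heB : S.IsIsometry eB.hom)
    (hArises : S.ArisesFromBaseFrobeniusPair (D.G.map (h.Ψ.functor.mapAut R.AN))
      (h.Ψ.functor.map D.α₂) (h.Ψ.functor.map D.α₁ ≫ eA.hom))
    (hpull₂ : ∀ {X Y Z : S.C} (φ : X ⟶ Y) (χ : Y ⟶ Z) (g : S.biratUnits Z),
      pullFrac (φ ≫ χ) g = pullFrac φ (pullFrac χ g))
    -- the unit of `B_N` over `u` along the transition `β_{1,N}` and its birational clauses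
    (ut : Aut R.BN) (hut : ut ∈ S.units R.BN) (hover : ut.hom ≫ b = b ≫ u.hom)
    {root' : S.biratUnits R.AN}
    (hfracN : S.fracOf R.pair.num (R.pair.den ≫ ut.hom) R.pair.isPreStep_num
      (S.isPreStep_comp_aut R.pair.isPreStep_den ut) (S.baseEquivalent_comp_unit R.pair.base_eq hut) = root')
    (hdisjN : S.DisjointSupports (S.div R.pair.num) (S.div (R.pair.den ≫ ut.hom)))
    (hpow : root' ^ (N : ℕ) = pullFrac D.α₁ f')
    (hsat : S.IsSaturated R.AN N (pullFrac D.α₁ f'))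
    -- Prop 4.2 (iv) at the twisted level-1 pair
    (hivP' : ∀ (R' R'' : S.NthRoot f' (R₁.pair.twistUnit u hu hfrac hdisj) N pullFrac)
      (ebs : S.base.obj R'.AN ≅ S.base.obj R''.AN), S.base.map R'.α = ebs.hom ≫ S.base.map R''.α →
        ∃ (v : S.mu R'.BN N) (ζA : R'.AN ≅ R''.AN) (ζB : R'.BN ≅ R''.BN),
          ζA.hom ≫ R''.pair.num = R'.pair.num ≫ ζB.hom ∧
          ζA.hom ≫ R''.pair.den = (R'.pair.den ≫ (v : Aut R'.BN).hom) ≫ ζB.hom ∧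
          ζA.hom ≫ R''.α = R'.α ∧ ζB.hom ≫ R''.β = R'.β ∧ S.base.mapIso ζA = ebs)
    (ebs : S.base.obj R.AN ≅ S.base.obj (h.Ψ.functor.obj R.AN))
    (hebs : S.base.map a = ebs.hom ≫ S.base.map (h.Ψ.functor.map a ≫ eA.hom))

include ψ hpull hii h3 h4b h8 h15a h15 comm_num comm_den ha hb hdega hdegb hD hfrac hdisj hnum hden hf heA heB hArises
  hpull₂ hut hover hfracN hdisjN hpow hsat hivP' hebs in
/-- **p438241 at the rebased root `R̃_N`** (abc-iut-L2-d4's FILE 2, generic half): with the normalised LEVEL-1 anchor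
`(eA, eB, u)` fixing the `u`-twisted level-1 pair, a unit `ũ ∈ O^×(B_N)` over `u` ALONG `β_{1,N}`, and Prop. 4.2 (iv) at the
twisted level-1 pair, there is a per-level transport datum `(a′ : Ψ A_N ≅ A_N, b′ : Ψ B_N ≅ B_N, e := 1, D_c := 1, D_p := v·ũ)`,
`v ∈ μ_N(B_N)`, transporting `s′_N` on the nose and `s″_N` up to `D_p`, COHERENT WITH THE ANCHOR ALONG THE TRANSITIONS:
`a′⁻¹ ≫ Ψ α_{1,N} ≫ eA = α_{1,N}`, `b′⁻¹ ≫ Ψ β_{1,N} ≫ eB = β_{1,N}` — the `hΨα`/`hΨβ` clauses of the anchored-family capstone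
verbatim — and `Base(a′) = ebs⁻¹`. [cite: MochizukiEtTh2009, Prop 4.2 (iv) p.315 (PDF p.89); Rmk 4.3.2 p.318–319 (PDF
pp.92–93); Thm 5.7 p.330 (PDF p.104)] -/
theorem exists_unit_transport_twisted_rebase :
    ∃ (a' : h.Ψ.functor.obj R.AN ≅ R.AN) (b' : h.Ψ.functor.obj R.BN ≅ R.BN) (e : R.AN ≅ R.AN) (Dc Dp : Aut R.BN),
      a'.inv ≫ h.Ψ.functor.map R.pair.num ≫ b'.hom = e.hom ≫ R.pair.num ≫ Dc.hom ∧
      a'.inv ≫ h.Ψ.functor.map R.pair.den ≫ b'.hom = e.hom ≫ R.pair.den ≫ Dp.hom ∧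
      Dc⁻¹ * Dp ∈ S.units R.BN ∧ e = Iso.refl _ ∧ Dc = 1 ∧ (∃ v ∈ S.mu R.BN N, Dp = v * ut) ∧
      a'.inv ≫ h.Ψ.functor.map a ≫ eA.hom = a ∧ b'.inv ≫ h.Ψ.functor.map b ≫ eB.hom = b ∧
      S.base.mapIso a' = ebs.symm :=
  exists_unit_transport_twisted h ψ pullFrac hpull hii h3 h4b h8 h15a h15
    (R.rebase R₁ a b comm_num comm_den ha hb hdega hdegb D hD) u hu hfrac hdisj eA eB hnum hden hf heA heB hArises hpull₂
    ut hut hover hfracN hdisjN hpow hsat hivP' ebs hebs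

include ψ hpull hii h3 h4b h8 h15a h15 comm_num comm_den ha hb hdega hdegb hD hfrac hdisj hnum hden hf heA heB hArises
  hpull₂ hut hover hfracN hdisjN hpow hsat hivP' hebs in
/-- **The level-`N` member of the coherent family, in the EXACT shape of the `hfam` binder of abc-iut-L2-d4's anchored
capstone** (`Discharge/Sec5Thm57AnchoredFamily.lean`, p442166): `∃ (a′, b′, w)`, `w ∈ O^×(B_N)` (namely `w = v·ũ`,
`v ∈ μ_N(B_N)`), `a′⁻¹ ≫ Ψ s′_N ≫ b′ = s′_N`, `a′⁻¹ ≫ Ψ s″_N ≫ b′ = s″_N ≫ w`, `a′⁻¹ ≫ Ψ α_{1,N} ≫ eA = α_{1,N}`,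
`b′⁻¹ ≫ Ψ β_{1,N} ≫ eB = β_{1,N}` — for the normalised level-1 anchor `(eA, eB, u)`. [cite: MochizukiEtTh2009, Thm 5.7 p.330
(PDF p.104); Rmk 4.3.2 p.318–319 (PDF pp.92–93); Prop 4.2 (iv) p.315 (PDF p.89)] -/
theorem exists_coherent_family_member_rebase :
    ∃ (a' : h.Ψ.functor.obj R.AN ≅ R.AN) (b' : h.Ψ.functor.obj R.BN ≅ R.BN) (w : Aut R.BN),
      w ∈ S.units R.BN ∧
      a'.inv ≫ h.Ψ.functor.map R.pair.num ≫ b'.hom = R.pair.num ∧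
      a'.inv ≫ h.Ψ.functor.map R.pair.den ≫ b'.hom = R.pair.den ≫ w.hom ∧
      a'.inv ≫ h.Ψ.functor.map a ≫ eA.hom = a ∧ b'.inv ≫ h.Ψ.functor.map b ≫ eB.hom = b := by
  obtain ⟨a', b', e, Dc, Dp, hn, hd, hunit, he, hDc, -, hα, hβ, -⟩ :=
    exists_unit_transport_twisted_rebase h ψ pullFrac hpull hii h3 h4b h8 h15a h15 R R₁ a b comm_num comm_den ha hb hdega
      hdegb D hD u hu hfrac hdisj eA eB hnum hden hf heA heB hArises hpull₂ ut hut hover hfracN hdisjN hpow hsat hivP' ebs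
      hebs
  subst he hDc
  refine ⟨a', b', Dp, ?_, ?_, ?_, hα, hβ⟩
  · rw [inv_one, one_mul] at hunit
    exact hunit
  · rw [hn, Iso.refl_hom, Category.id_comp]
    exact Category.comp_id _
  · rw [hd, Iso.refl_hom, Category.id_comp]

end

end NthRoot

end BiKummerSetting

end Literature.AnabelianGeometry.EtaleTheta

end
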